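import Literature.MathematicalPhysics.QuantumFieldTheory.Balaban1983to89.B9Eq342GradientRowPureGauge
import Literature.MathematicalPhysics.QuantumFieldTheory.Balaban1983to89.B9Eq342GradientRowNaturalPerturbation
import Literature.MathematicalPhysics.QuantumFieldTheory.Balaban1983to89.B9Eq342GradientRowRepresentation
import Literature.MathematicalPhysics.QuantumFieldTheory.Balaban1983to89.B9Eq323KatoCutoffCommutator
import Literature.MathematicalPhysics.QuantumFieldTheory.Balaban1983to89.B9Eq373KatoPairedRemainder

/-!
# `Balaban1983to89.B9Eq342GradientRowAssembly` — T. Bałaban, *Propagators for lattice gauge theories in a background field*, Commun. Math. Phys. **99**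
# (1985) 389–434 [Balaban1985BackgroundPropagators] Thm 3.1 (3.42) p. 397 (second entry, the covariant-gradient row `|∇^η_U G λ| ≤ B₀e^{−δ₀d}|λ|`),
# (3.23) p. 394, (3.35) p. 396, (3.43)–(3.46) p. 398: **STOREY J ASSEMBLED IN THE CHAIN's CURRENCY, AT THE PLAIN RESOLVENT — for transporter data `U`
# (`S(b)R(b) = 1`, contractions), `(Δ_U + m)u = h` on `TSite d N`, a weighted value row `‖u(y)‖ ≤ N_u·W_{x₀}(y)` and weighted data `‖h(y)‖ ≤ Γ·W_{x₀}(y)`,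
# and, for EVERY output bond `b₀`, a cutoff `χ_{b₀}` (`|χ| ≤ 1`, `= 1` at `b₀`'s ends, lattice-Lipschitz letters `c∕r`, `c∕r²`) and a pure comparison
# gauge `1^{g_{b₀}}` whose transporters agree with `U`'s on the cutoff's 1-neighbourhood up to the displayed fibre letters `δ`, `b`, `b′` (the (3.35) cube):
# `‖(∇_U u)(b)‖ ≤ (|t|(Γ + ε₂N_u) + (|t|δ∕β)N_u)∕(1 − |t|ε₁)·(B_{b.2}·W_{x₀}(b₊))` for EVERY bond `b`, with `ε₁ = (c∕r + |t|b)·(e^{a} + 1)·Σ_ν B_ν` and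
# `ε₂ = d(c∕r² + |t|b(c∕r)(1 + e^{a}) + t²(b′ + b²))` — the contraction binder `|t|ε₁ < 1` DISPLAYED (met t-free by `B9Eq342GradientRowNaturalPerturbation` §T
# with `B9Eq342GradientRowComparisonMassUniform`)**

statement-level skeleton of published theorems with citation tags; proofs where landed; nothing here is a claim about the Yang–Mills mass gap

CITATION HEADER (lean-in-tree rule).  Audit cell `pub-balaban`, sub-cell `t4`, BINDER row NE9; filed by NE9 crux-team LEAF PROVER 05
(`b2b-balaban-t4-ne9-formalise-leaf-05`, gen 84).  SOURCE READ first-hand in the held text layer [Balaban1985BackgroundPropagators]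
(`paper:balaban1985-cmp99-background-propagators`): p. 397 Thm 3.1 (3.42); p. 394 (3.23); p. 396 (3.35); p. 398 (3.43)–(3.46).  Print proves the row by the random
walk expansion of Sect. 3 (pp. 398–409); the cell's storey J is a weighted sup-norm contraction (t4-ne9-idea-1 gens 111–145: N17 ∕ N22 ∕ P-J-2 ∕ P-J-3 ∕ P-J-4 ∕
N44–N46; this lineage gens 77–84).  THIS file is a [folklore] COMPOSITION BY NAME of tree lemmas — (K34) `B9Eq342GradientRowPureGauge` §4 (response letter at a
bond-dependent family of pure gauges + the bootstrap `B9Eq342GradientRowBootstrap` §4), (K38) `B9Eq342GradientRowNaturalPerturbation` (natural letter ⇒ `hV`),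
(K40) `B9Eq342GradientRowRepresentation` (the `hrep` shape), (CO) `B9Eq323KatoCutoffCommutator` §3, (PV) `B9Eq373KatoPairedRemainder`, (K30)
`B9Eq331PureGaugeResolventConjugation` §6 (pure-gauge transporter letters); nothing printed is a hypothesis except the positivity `hAd` of the gauge's `Ad`.

WHAT IS PROVED (sorry-free; 0 `def`; [folklore]).
* §1 **`equiv_covLaplaceSiteK_eq_zero_of_vanish`** — locality of the Kato-form (3.23): `f = 0` on `{x, x ± e_μ}` ⟹ `(Δ_U f)(x) = 0`.
* §2 **`natural_letter_of_cutoff`** — for ANY comparison data `(R⁰, S⁰)` with `S⁰` contracting: the perturbation of the representation step,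
  `V(y) := −([(Δ_U g)(y) − χ(y)•(Δ_U u)(y)] + [(Δ_{U⁰} g)(y) − (Δ_U g)(y)])`, `g = χu`, obeys the NATURAL letter
  `‖V(y)‖ ≤ (c∕r + |t|b)·Σ_ν(‖(∇_U u)(y,ν)‖ + ‖(∇_U u)(y−e_ν,ν)‖) + ε₂·N_u·W_{x₀}(y)` given the cutoff letters at `y`, the fibre letters `b`, `b′` on a set `Ω`
  off which `χ` vanishes with its neighbours, and the weighted value row.
* §3 **`norm_covDeriv_le_weighted_of_letters`** — THE ASSEMBLY above (every binder of (K34) §4 discharged: `hT` by (K34) §2, `hrep` by (K40) §4 + §1,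
  `hg` by (K40) §5, `hV` by §2 + (K38) `pert_of_natural_bond`, `hw′` by `β ≤ B_ν`; `hθ` displayed).
* §4 `div_one_sub_le_two_mul`, **`norm_covDeriv_le_weighted_of_letters_uniform`** — §3 with `hθ` DISCHARGED by (K38) §T from `a ≤ κ`, the t-free letter
  `|t|·B_ν ≤ C ≤ K∕√m` ((K37), entered as hypotheses) and the mass choice `2(c∕r + |t|b)(e^{κ}+1)dK ≤ √m`: `θ ≤ 1∕2` and the bound `2·(…)·(B_{b.2}·W_{x₀}(b₊))`.
* §5 **`norm_covDeriv_le_weighted_of_letters_penalty`** — an order-zero term `p` of the operator (`(Δ_U + m)u + p = h`, `‖p(y)‖ ≤ N_p·W_{x₀}(y)`: print's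
  averaging penalty (3.24)) is DATA: §3 with `Γ + N_p`, the contraction letter unchanged — no smallness of the penalty is needed.
HONEST SCOPE.  The PLAIN resolvent `(Δ_U + m)⁻¹` of (3.23) only — print's `G(U)` ∕ `G′(U)` carry the averaging penalty and the local part `A₀` of [B11] (134) is a
bond-field operator: their representation steps are the OWNER's assembly (the penalty is block-local and enters `V` as a value term; not done here); the fibre
letters `δ`, `b`, `b′`, the cutoffs and the value row `N_u` are DISPLAYED (suppliers: `B9Eq387CubeReductionGaugeBackground`, `B9Eq384RemainderLetters`, (K30)–(K32),
storey D's `B9Eq342SupNormBootstrapWeighted`); constants symbolic, not valued; whether `|t|b`, `t²b′` are t-free is the (3.35) window's matter (N46 (F24)).  NOT summit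
progress (cell pub-balaban: NE9 NOT PRINTED ∕ NOT PROVED; «NE9 ⇐ the named binders»; row WALLED ON A MODEL (O-NE9-1; #5 UNRULED); spine PROVED 0∕9; rung (B)+1
finite T⁴ — NOT infinite volume, NOT mass gap, NOT BetaPertH, NOT Clay).  HONEST DEPENDENCY (cell line): continuum YM on T⁴ ⇐ BetaPertH ∧ nine spine estimates
(0/9 proved); BetaPertH ⇐ (D1) ∧ (D4) ∧ CAP+tail; G-an2-4 gates asym, D1 and NE2/3/4.  NEW file; nothing modified.  Net new unproved facts: 0.
-/

noncomputable section

open scoped BigOperators InnerProductSpace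

namespace Literature.MathematicalPhysics.QuantumFieldTheory.Balaban1983to89.B9Eq342GradientRowAssembly

open B4Sect5Torus (TSite)
open B9SectCLatticeCarrier (Bond bpos btgt shift unshift shift_unshift unshift_shift)
open B4TorusKernel.MultiPeriod (circAbs)
open B9Eq311L2Pairing (WL2)
open B9Eq310HessianOperator (adTransportW)
open B11Eq103H1Complex (SiteL2K covLaplaceSiteK covDerivL2K greenK)
open B9Eq328GaugeAction (gaugeU AdW)
open B9Eq323KatoDomination (equiv_covLaplaceSiteK_eq_sum)
open B9Eq323KatoCutoffCommutator (norm_equiv_covLaplaceSiteK_cutoff_sub_le_natural)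
open B9Eq373KatoPairedRemainder (norm_equiv_covLaplaceSiteK_sub_le_paired)
open B9Eq331PureGaugeResolventConjugation (adTransportW_inv_adTransportW norm_adTransportW_pureGauge_inv)
open B9Eq331PureGaugeResolventLetters (rePos_covLaplaceSiteK_pureGauge_add)
open B9Eq342GradientRowPureGauge (norm_le_of_gradient_response_bootstrap_pureGauge_family)
open B9Eq342GradientRowNaturalPerturbation (pert_of_natural_bond weight_site_unshift_le weight_site_pos theta_le theta_le_half)
open B9Eq342GradientRowRepresentation (cutoff_comparison_identity norm_equiv_covDerivL2K_cutoff_le norm_covDeriv_le_response_add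
  norm_cutoff_data_le conversion_slot_le)

variable {𝕜 : Type*} [RCLike 𝕜] {d : ℕ} {N : Fin d → ℕ} {W : Type*} [NormedAddCommGroup W] [InnerProductSpace 𝕜 W] {c₀ : ℝ} [Fact (0 < c₀)]

/-! ## §1 Locality of the Kato-form Laplacian -/

/-- **(3.23) IS LOCAL**: if `f` vanishes at `x` and at its `2d` neighbours then `(Δ_U f)(x) = 0` (Kato form `B9Eq323KatoDomination.equiv_covLaplaceSiteK_eq_sum`).
[folklore] [cite: Balaban1985BackgroundPropagators, (3.23) p.394] -/
theorem equiv_covLaplaceSiteK_eq_zero_of_vanish (t : ℝ) (R S : Bond d N → W →ₗ[𝕜] W) (hSR : ∀ b w, S b (R b w) = w) (f : SiteL2K 𝕜 d N c₀ W)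
    (x : TSite d N) (h0 : WL2.equiv 𝕜 _ W f x = 0) (hp : ∀ μ, WL2.equiv 𝕜 _ W f (shift μ x) = 0) (hm : ∀ μ, WL2.equiv 𝕜 _ W f (unshift μ x) = 0) :
    WL2.equiv 𝕜 _ W (covLaplaceSiteK (t : 𝕜) R S f) x = 0 := by
  rw [equiv_covLaplaceSiteK_eq_sum t R S hSR f x]
  exact Finset.sum_eq_zero fun μ _ => by rw [h0, hp μ, hm μ, map_zero, map_zero, sub_zero, add_zero, smul_zero]

/-! ## §2 The natural letter of the representation step's perturbation -/

section NaturalLetter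

variable [∀ μ, NeZero (N μ)]

/-- **THE NATURAL LETTER OF STOREY J's PERTURBATION.**  Transporter data `(R, S)` (`S(b)R(b) = 1`, `R`, `S` contracting) and ANY comparison data `(R⁰, S⁰)`
(`S⁰(b)R⁰(b) = 1`, `S⁰` contracting); `g = χu` pointwise with `|χ| ≤ 1` and the lattice-Lipschitz letters `c∕r`, `c∕r²` at `y`; a set `Ω` such that off `Ω` the cutoff
vanishes together with its neighbours, and ON `Ω` the two-background fibre letters of `B9Eq373KatoPairedRemainder` hold with `b`, `b′ ≥ 0` (comparison FIRST); the
weighted value row `‖u(z)‖ ≤ N_u·W_{x₀}(z)` for the product-`cosh` weight at rate `a ≥ 0`.  Then at `y`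
`‖[(Δ_U g)(y) − χ(y)•(Δ_U u)(y)] + [(Δ_{U⁰} g)(y) − (Δ_U g)(y)]‖ ≤ (c∕r + |t|b)·Σ_ν(‖(∇_U u)(y,ν)‖ + ‖(∇_U u)(y−e_ν,ν)‖) + ε₂·N_u·W_{x₀}(y)`,
`ε₂ = d(c∕r²) + |t|b(c∕r)·d(1 + e^{a}) + d·t²(b′ + b²)` — (CO) §3 + (PV) + `B9Eq342GradientRowRepresentation` §2 + the weight's one-step ratio. [folklore]
[cite: Balaban1985BackgroundPropagators, (3.23) p.394, (3.43) p.398, (3.46) p.398, (3.35) p.396] -/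
theorem natural_letter_of_cutoff (t : ℝ) (R S R₀ S₀ : Bond d N → W →ₗ[𝕜] W) (hSR : ∀ b w, S b (R b w) = w) (hSR₀ : ∀ b w, S₀ b (R₀ b w) = w)
    (hRc : ∀ b w, ‖R b w‖ ≤ ‖w‖) (hSc : ∀ b w, ‖S b w‖ ≤ ‖w‖) (hS₀c : ∀ b w, ‖S₀ b w‖ ≤ ‖w‖)
    (u g : SiteL2K 𝕜 d N c₀ W) (χ : TSite d N → ℝ) (hg : ∀ y, WL2.equiv 𝕜 _ W g y = ((χ y : ℝ) : 𝕜) • WL2.equiv 𝕜 _ W u y) (hχ : ∀ y, |χ y| ≤ 1)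
    {c r : ℝ} (hcr : 0 ≤ c / r) (hcr2 : 0 ≤ c / r ^ 2) (h1p : ∀ x μ, |t * (χ (shift μ x) - χ x)| ≤ c / r)
    (h1m : ∀ x μ, |t * (χ x - χ (unshift μ x))| ≤ c / r) (h2 : ∀ x μ, |t ^ 2 * (2 * χ x - χ (shift μ x) - χ (unshift μ x))| ≤ c / r ^ 2)
    (Ω : Set (TSite d N)) (hΩ : ∀ x, x ∉ Ω → χ x = 0 ∧ (∀ μ, χ (shift μ x) = 0) ∧ (∀ μ, χ (unshift μ x) = 0))
    {b b' : ℝ} (hb : 0 ≤ b) (hb' : 0 ≤ b')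
    (hBp : ∀ x ∈ Ω, ∀ μ w, ‖R₀ (x, μ) (S (x, μ) w) - w‖ ≤ b * ‖w‖)
    (hBm : ∀ x ∈ Ω, ∀ μ w, ‖R₀ (unshift μ x, μ) (S (unshift μ x, μ) w) - w‖ ≤ b * ‖w‖)
    (hBt : ∀ x ∈ Ω, ∀ μ w, ‖S₀ (unshift μ x, μ) w - S (unshift μ x, μ) w‖ ≤ b * ‖w‖)
    (hD : ∀ x ∈ Ω, ∀ μ w, ‖(R₀ (x, μ) (S (x, μ) w) - w) -
      S₀ (unshift μ x, μ) (R₀ (unshift μ x, μ) (S (unshift μ x, μ) (R₀ (unshift μ x, μ) w)) - R₀ (unshift μ x, μ) w)‖ ≤ b' * ‖w‖)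
    {a : ℝ} (ha : 0 ≤ a) (x₀ : TSite d N) {Nu : ℝ} (hNu : 0 ≤ Nu)
    (hval : ∀ z, ‖WL2.equiv 𝕜 _ W u z‖ ≤ Nu * ∏ μ, Real.cosh (a * (circAbs (N μ) ((((x₀ μ : ℕ) : ZMod (N μ)) - ((z μ : ℕ) : ZMod (N μ))).val) : ℝ)))
    (y : TSite d N) :
    ‖(WL2.equiv 𝕜 _ W (covLaplaceSiteK (t : 𝕜) R S g) y - ((χ y : ℝ) : 𝕜) • WL2.equiv 𝕜 _ W (covLaplaceSiteK (t : 𝕜) R S u) y) +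
        (WL2.equiv 𝕜 _ W (covLaplaceSiteK (t : 𝕜) R₀ S₀ g) y - WL2.equiv 𝕜 _ W (covLaplaceSiteK (t : 𝕜) R S g) y)‖ ≤
      (c / r + |t| * b) * (∑ ν, (‖WL2.equiv 𝕜 _ W (covDerivL2K 𝕜 c₀ (t : 𝕜) R u) (y, ν)‖ +
          ‖WL2.equiv 𝕜 _ W (covDerivL2K 𝕜 c₀ (t : 𝕜) R u) (unshift ν y, ν)‖)) +
        ((d : ℝ) * (c / r ^ 2) + |t| * b * (c / r) * ((d : ℝ) * (1 + Real.exp a)) + (d : ℝ) * (t ^ 2 * (b' + b * b))) * Nu *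
          ∏ μ, Real.cosh (a * (circAbs (N μ) ((((x₀ μ : ℕ) : ZMod (N μ)) - ((y μ : ℕ) : ZMod (N μ))).val) : ℝ)) := by
  -- abbreviations
  set Wt : TSite d N → ℝ := fun z => ∏ μ, Real.cosh (a * (circAbs (N μ) ((((x₀ μ : ℕ) : ZMod (N μ)) - ((z μ : ℕ) : ZMod (N μ))).val) : ℝ)) with hWt
  set Du : Bond d N → W := fun bb => WL2.equiv 𝕜 _ W (covDerivL2K 𝕜 c₀ (t : 𝕜) R u) bb with hDu
  set Dg : Bond d N → W := fun bb => WL2.equiv 𝕜 _ W (covDerivL2K 𝕜 c₀ (t : 𝕜) R g) bb with hDg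
  have hWpos : ∀ z, 0 < Wt z := fun z => weight_site_pos a x₀ z
  have hWy := hWpos y
  have hNW : 0 ≤ Nu * Wt y := mul_nonneg hNu hWy.le
  -- the value row at `y` and at the backward neighbours
  have huy : ‖WL2.equiv 𝕜 _ W u y‖ ≤ Nu * Wt y := hval y
  have hum : ∀ μ, ‖WL2.equiv 𝕜 _ W u (unshift μ y)‖ ≤ Nu * (Real.exp a * Wt y) := fun μ =>
    (hval (unshift μ y)).trans (mul_le_mul_of_nonneg_left (weight_site_unshift_le ha x₀ y μ) hNu)
  -- the cutoff commutator, natural form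
  have hC := norm_equiv_covLaplaceSiteK_cutoff_sub_le_natural t R S hSR hSc u g χ hg y hcr (h1p y) (h1m y) (h2 y)
  -- ‖g y‖ ≤ ‖u y‖
  have hgy : ‖WL2.equiv 𝕜 _ W g y‖ ≤ ‖WL2.equiv 𝕜 _ W u y‖ := by
    rw [hg y, norm_smul, RCLike.norm_ofReal]
    exact (mul_le_mul_of_nonneg_right (hχ y) (norm_nonneg _)).trans (by rw [one_mul])
  -- the covariant derivatives of `g` against those of `u`
  have hDgp : ∀ μ, ‖Dg (y, μ)‖ ≤ ‖Du (y, μ)‖ + c / r * ‖WL2.equiv 𝕜 _ W u y‖ := fun μ => by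
    have h := norm_equiv_covDerivL2K_cutoff_le t R u g χ hg y μ
    have e1 : |χ (shift μ y)| * ‖Du (y, μ)‖ ≤ 1 * ‖Du (y, μ)‖ := mul_le_mul_of_nonneg_right (hχ _) (norm_nonneg _)
    have e2 : |t * (χ (shift μ y) - χ y)| * ‖WL2.equiv 𝕜 _ W u y‖ ≤ c / r * ‖WL2.equiv 𝕜 _ W u y‖ :=
      mul_le_mul_of_nonneg_right (h1p y μ) (norm_nonneg _)
    simp only [hDg, hDu] at h e1 ⊢
    linarith
  have hDgm : ∀ μ, ‖Dg (unshift μ y, μ)‖ ≤ ‖Du (unshift μ y, μ)‖ + c / r * ‖WL2.equiv 𝕜 _ W u (unshift μ y)‖ := fun μ => by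
    have h := norm_equiv_covDerivL2K_cutoff_le t R u g χ hg (unshift μ y) μ
    rw [shift_unshift] at h
    have e1 : |χ y| * ‖Du (unshift μ y, μ)‖ ≤ 1 * ‖Du (unshift μ y, μ)‖ := mul_le_mul_of_nonneg_right (hχ _) (norm_nonneg _)
    have e2 : |t * (χ y - χ (unshift μ y))| * ‖WL2.equiv 𝕜 _ W u (unshift μ y)‖ ≤ c / r * ‖WL2.equiv 𝕜 _ W u (unshift μ y)‖ :=
      mul_le_mul_of_nonneg_right (h1m y μ) (norm_nonneg _)
    simp only [hDg, hDu] at h e1 ⊢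
    linarith
  -- the two-background remainder: natural bound (on Ω by (PV), off Ω it vanishes)
  have hP : ‖WL2.equiv 𝕜 _ W (covLaplaceSiteK (t : 𝕜) R₀ S₀ g) y - WL2.equiv 𝕜 _ W (covLaplaceSiteK (t : 𝕜) R S g) y‖ ≤
      |t| * b * (∑ μ, (‖Du (y, μ)‖ + ‖Du (unshift μ y, μ)‖)) +
        (|t| * b * (c / r) * ((d : ℝ) * (1 + Real.exp a)) + (d : ℝ) * (t ^ 2 * (b' + b * b))) * Nu * Wt y := by
    by_cases hy : y ∈ Ω
    · have hPV := norm_equiv_covLaplaceSiteK_sub_le_paired t R₀ S₀ R S hSR₀ hSR g y hb (hBp y hy) (hBm y hy) (hBt y hy) (hD y hy)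
        (fun μ w => hS₀c _ w) (fun μ w => hRc _ w)
      -- first-order terms of `g` against those of `u`
      have hsum : ∑ μ, (‖Dg (y, μ)‖ + ‖Dg (unshift μ y, μ)‖) ≤
          ∑ μ, (‖Du (y, μ)‖ + ‖Du (unshift μ y, μ)‖) + c / r * ((d : ℝ) * (1 + Real.exp a)) * (Nu * Wt y) := by
        have step : ∀ μ, ‖Dg (y, μ)‖ + ‖Dg (unshift μ y, μ)‖ ≤
            (‖Du (y, μ)‖ + ‖Du (unshift μ y, μ)‖) + c / r * ((1 + Real.exp a) * (Nu * Wt y)) := fun μ => by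
          have a1 := hDgp μ
          have a2 := hDgm μ
          have v1 : c / r * ‖WL2.equiv 𝕜 _ W u y‖ ≤ c / r * (Nu * Wt y) := mul_le_mul_of_nonneg_left huy hcr
          have v2 : c / r * ‖WL2.equiv 𝕜 _ W u (unshift μ y)‖ ≤ c / r * (Real.exp a * (Nu * Wt y)) :=
            mul_le_mul_of_nonneg_left ((hum μ).trans (le_of_eq (by ring))) hcr
          nlinarith
        calc ∑ μ, (‖Dg (y, μ)‖ + ‖Dg (unshift μ y, μ)‖)
            ≤ ∑ μ, ((‖Du (y, μ)‖ + ‖Du (unshift μ y, μ)‖) + c / r * ((1 + Real.exp a) * (Nu * Wt y))) := Finset.sum_le_sum fun μ _ => step μ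
          _ = ∑ μ, (‖Du (y, μ)‖ + ‖Du (unshift μ y, μ)‖) + c / r * ((d : ℝ) * (1 + Real.exp a)) * (Nu * Wt y) := by
              rw [Finset.sum_add_distrib, Finset.sum_const, Finset.card_univ, Fintype.card_fin, nsmul_eq_mul]; ring
      have htb : 0 ≤ |t| * b := mul_nonneg (abs_nonneg t) hb
      have hval2 : (d : ℝ) * (t ^ 2 * (b' + b * b)) * ‖WL2.equiv 𝕜 _ W g y‖ ≤ (d : ℝ) * (t ^ 2 * (b' + b * b)) * (Nu * Wt y) :=
        mul_le_mul_of_nonneg_left (hgy.trans huy) (by positivity)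
      have h1 := mul_le_mul_of_nonneg_left hsum htb
      calc _ ≤ |t| * b * ∑ μ, (‖Dg (y, μ)‖ + ‖Dg (unshift μ y, μ)‖) + (d : ℝ) * (t ^ 2 * (b' + b * b)) * ‖WL2.equiv 𝕜 _ W g y‖ := by
              simpa [hDg] using hPV
        _ ≤ |t| * b * (∑ μ, (‖Du (y, μ)‖ + ‖Du (unshift μ y, μ)‖) + c / r * ((d : ℝ) * (1 + Real.exp a)) * (Nu * Wt y)) +
              (d : ℝ) * (t ^ 2 * (b' + b * b)) * (Nu * Wt y) := add_le_add h1 hval2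
        _ = _ := by ring
    · -- off Ω: `g` vanishes at `y` and its neighbours, so both Laplacians of `g` vanish at `y`
      obtain ⟨h0, hp', hm'⟩ := hΩ y hy
      have g0 : WL2.equiv 𝕜 _ W g y = 0 := by rw [hg, h0]; simp
      have gp : ∀ μ, WL2.equiv 𝕜 _ W g (shift μ y) = 0 := fun μ => by rw [hg, hp' μ]; simp
      have gm : ∀ μ, WL2.equiv 𝕜 _ W g (unshift μ y) = 0 := fun μ => by rw [hg, hm' μ]; simp
      rw [equiv_covLaplaceSiteK_eq_zero_of_vanish t R₀ S₀ hSR₀ g y g0 gp gm, equiv_covLaplaceSiteK_eq_zero_of_vanish t R S hSR g y g0 gp gm,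
        sub_zero, norm_zero]
      have hs : 0 ≤ ∑ μ, (‖Du (y, μ)‖ + ‖Du (unshift μ y, μ)‖) := Finset.sum_nonneg fun μ _ => by positivity
      have : 0 ≤ (|t| * b * (c / r) * ((d : ℝ) * (1 + Real.exp a)) + (d : ℝ) * (t ^ 2 * (b' + b * b))) * Nu * Wt y := by positivity
      positivity
  -- assemble
  have hCval : (d : ℝ) * (c / r ^ 2) * ‖WL2.equiv 𝕜 _ W u y‖ ≤ (d : ℝ) * (c / r ^ 2) * (Nu * Wt y) :=
    mul_le_mul_of_nonneg_left huy (by positivity)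
  calc _ ≤ ‖WL2.equiv 𝕜 _ W (covLaplaceSiteK (t : 𝕜) R S g) y - ((χ y : ℝ) : 𝕜) • WL2.equiv 𝕜 _ W (covLaplaceSiteK (t : 𝕜) R S u) y‖ +
          ‖WL2.equiv 𝕜 _ W (covLaplaceSiteK (t : 𝕜) R₀ S₀ g) y - WL2.equiv 𝕜 _ W (covLaplaceSiteK (t : 𝕜) R S g) y‖ := norm_add_le _ _
    _ ≤ ((d : ℝ) * (c / r ^ 2) * ‖WL2.equiv 𝕜 _ W u y‖ + c / r * ∑ μ, (‖Du (y, μ)‖ + ‖Du (unshift μ y, μ)‖)) +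
          (|t| * b * (∑ μ, (‖Du (y, μ)‖ + ‖Du (unshift μ y, μ)‖)) +
            (|t| * b * (c / r) * ((d : ℝ) * (1 + Real.exp a)) + (d : ℝ) * (t ^ 2 * (b' + b * b))) * Nu * Wt y) :=
        add_le_add (by simpa [hDu] using hC) hP
    _ ≤ ((d : ℝ) * (c / r ^ 2) * (Nu * Wt y) + c / r * ∑ μ, (‖Du (y, μ)‖ + ‖Du (unshift μ y, μ)‖)) +
          (|t| * b * (∑ μ, (‖Du (y, μ)‖ + ‖Du (unshift μ y, μ)‖)) +
            (|t| * b * (c / r) * ((d : ℝ) * (1 + Real.exp a)) + (d : ℝ) * (t ^ 2 * (b' + b * b))) * Nu * Wt y) := by linarith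
    _ = _ := by simp only [hDu, hWt]; ring

end NaturalLetter

/-! ## §3 The assembly: storey J's gradient row of the plain resolvent, every binder of the bootstrap discharged but `hθ` -/

section Assembly

variable [∀ μ, NeZero (N μ)] {𝔸 : Type*} [Ring 𝔸] [Algebra ℂ 𝔸] {V : Type*} [NormedAddCommGroup V] [InnerProductSpace ℂ V] [FiniteDimensional ℂ V]
  (φ : V ≃ₗ[ℂ] 𝔸) {c₁ : ℝ} [Fact (0 < c₁)] (t m a : ℝ) (hm : 0 < m) (x₀ : TSite d N) (gf : Bond d N → TSite d N → 𝔸ˣ)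
  (hAdf : ∀ (b₀ : Bond d N) (x : TSite d N) (v v' : V), ⟪AdW φ (gf b₀ x) v, AdW φ (gf b₀ x) v'⟫_ℂ = ⟪v, v'⟫_ℂ)

/-- (local, syntactic) the product-`cosh` weight at `x₀`, (K24)'s direction constant, the `b₀`-th pure-gauge transporters and comparison operator. -/
local notation "WT" => (fun y : TSite d N => ∏ μ, Real.cosh (a * (circAbs (N μ) (ZMod.val (((x₀ μ : ℕ) : ZMod (N μ)) - ((y μ : ℕ) : ZMod (N μ)))) : ℝ)))
local notation "BC" => (fun ν : Fin d => (1 + Real.exp (-a)) * ((1 + 2 * t / (N ν * Real.sqrt (m - 2 * ((d : ℝ) - 1) * t ^ 2 * (Real.cosh a - 1)))) /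
      Real.sqrt ((m - 2 * ((d : ℝ) - 1) * t ^ 2 * (Real.cosh a - 1)) ^ 2 + 4 * (m - 2 * ((d : ℝ) - 1) * t ^ 2 * (Real.cosh a - 1)) * t ^ 2)) +
    2 * Real.sinh a / (m - 2 * (d : ℝ) * t ^ 2 * (Real.cosh a - 1)))
local notation "RP[" b₀ "]" => (adTransportW φ (gaugeU (gf b₀) 1) : Bond d N → V →ₗ[ℂ] V)
local notation "SP[" b₀ "]" => (adTransportW φ (fun bb => (gaugeU (gf b₀) 1 bb)⁻¹) : Bond d N → V →ₗ[ℂ] V)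
local notation "TP[" b₀ "]" => (covLaplaceSiteK (c₀ := c₁) ((t : ℝ) : ℂ) (adTransportW φ (gaugeU (gf b₀) 1)) (adTransportW φ fun bb => (gaugeU (gf b₀) 1 bb)⁻¹) +
    ((m : ℝ) : ℂ) • LinearMap.id : SiteL2K ℂ d N c₁ V →ₗ[ℂ] SiteL2K ℂ d N c₁ V)

include hAdf hm in
/-- **STOREY J ASSEMBLED (plain resolvent, weighted currency, `hθ` displayed).**  See the module header for the letters; the conclusion is the gradient row
`‖(∇_U u)(b)‖ ≤ (|t|(Γ + ε₂N_u) + (|t|δ∕β)N_u)∕(1 − |t|ε₁)·(B_{b.2}·W_{x₀}(b₊))` for EVERY bond `b`, `ε₁ = (c∕r + |t|b)·((e^{a} + 1)·Σ_ν B_ν)`,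
`ε₂ = d(c∕r²) + |t|b(c∕r)·d(1 + e^{a}) + d·t²(b′ + b²)`.  Composition BY NAME: (K34) §4 ← `hT` (K34) §2, `hrep` (K40) §4 + §1 + `conversion_slot_le`, `hg` (K40) §5,
`hV` (K38) `pert_of_natural_bond` ∘ §2. [folklore] [cite: Balaban1985BackgroundPropagators, Thm 3.1 (3.42) p.397, (3.23) p.394, (3.35) p.396, (3.43) p.398, (3.46) p.398] -/
theorem norm_covDeriv_le_weighted_of_letters (ht : 0 < t) (ha : 0 ≤ a) (hlam : 2 * (d : ℝ) * t ^ 2 * (Real.cosh a - 1) < m) (hn : ∀ ν, 2 ≤ N ν)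
    (R S : Bond d N → V →ₗ[ℂ] V) (hSR : ∀ b w, S b (R b w) = w) (hRc : ∀ b w, ‖R b w‖ ≤ ‖w‖) (hSc : ∀ b w, ‖S b w‖ ≤ ‖w‖)
    (u h : SiteL2K ℂ d N c₁ V) (hu : covLaplaceSiteK (t : ℂ) R S u + (m : ℂ) • u = h)
    {Γ Nu : ℝ} (hΓ : 0 ≤ Γ) (hNu : 0 ≤ Nu) (hh : ∀ y, ‖WL2.equiv ℂ _ V h y‖ ≤ Γ * WT y) (hval : ∀ y, ‖WL2.equiv ℂ _ V u y‖ ≤ Nu * WT y)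
    (χ : Bond d N → TSite d N → ℝ) (hχ1 : ∀ b₀ y, |χ b₀ y| ≤ 1) (hχp : ∀ b₀, χ b₀ (bpos b₀) = 1) (hχt : ∀ b₀, χ b₀ (btgt b₀) = 1)
    {c r : ℝ} (hcr : 0 ≤ c / r) (hcr2 : 0 ≤ c / r ^ 2) (h1p : ∀ b₀ x μ, |t * (χ b₀ (shift μ x) - χ b₀ x)| ≤ c / r)
    (h1m : ∀ b₀ x μ, |t * (χ b₀ x - χ b₀ (unshift μ x))| ≤ c / r) (h2 : ∀ b₀ x μ, |t ^ 2 * (2 * χ b₀ x - χ b₀ (shift μ x) - χ b₀ (unshift μ x))| ≤ c / r ^ 2)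
    (Ω : Bond d N → Set (TSite d N)) (hΩ : ∀ b₀ x, x ∉ Ω b₀ → χ b₀ x = 0 ∧ (∀ μ, χ b₀ (shift μ x) = 0) ∧ (∀ μ, χ b₀ (unshift μ x) = 0))
    {δ b b' : ℝ} (hδ0 : 0 ≤ δ) (hb : 0 ≤ b) (hb' : 0 ≤ b') (hδ : ∀ b₀ w, ‖R b₀ w - RP[b₀] b₀ w‖ ≤ δ * ‖w‖)
    (hBp : ∀ b₀, ∀ x ∈ Ω b₀, ∀ μ w, ‖RP[b₀] (x, μ) (S (x, μ) w) - w‖ ≤ b * ‖w‖)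
    (hBm : ∀ b₀, ∀ x ∈ Ω b₀, ∀ μ w, ‖RP[b₀] (unshift μ x, μ) (S (unshift μ x, μ) w) - w‖ ≤ b * ‖w‖)
    (hBt : ∀ b₀, ∀ x ∈ Ω b₀, ∀ μ w, ‖SP[b₀] (unshift μ x, μ) w - S (unshift μ x, μ) w‖ ≤ b * ‖w‖)
    (hD : ∀ b₀, ∀ x ∈ Ω b₀, ∀ μ w, ‖(RP[b₀] (x, μ) (S (x, μ) w) - w) -
      SP[b₀] (unshift μ x, μ) (RP[b₀] (unshift μ x, μ) (S (unshift μ x, μ) (RP[b₀] (unshift μ x, μ) w)) - RP[b₀] (unshift μ x, μ) w)‖ ≤ b' * ‖w‖)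
    {β : ℝ} (hβ : 0 < β) (hβB : ∀ ν, β ≤ BC ν)
    (hθ : ‖(t : ℂ)‖ * ((c / r + |t| * b) * ((Real.exp a + 1) * ∑ ν, BC ν)) < 1) (bnd : Bond d N) :
    ‖WL2.equiv ℂ _ V (covDerivL2K ℂ c₁ (t : ℂ) R u) bnd‖ ≤
      (‖(t : ℂ)‖ * (Γ + ((d : ℝ) * (c / r ^ 2) + |t| * b * (c / r) * ((d : ℝ) * (1 + Real.exp a)) + (d : ℝ) * (t ^ 2 * (b' + b * b))) * Nu) +
          |t| * δ / β * Nu) / (1 - ‖(t : ℂ)‖ * ((c / r + |t| * b) * ((Real.exp a + 1) * ∑ ν, BC ν))) * (BC bnd.2 * WT (btgt bnd)) := by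
  -- the cut-off fields `g_{b₀} = χ_{b₀}u`
  set gc : Bond d N → SiteL2K ℂ d N c₁ V := fun b₀ => (WL2.equiv ℂ (fun _ : TSite d N => c₁) V).symm fun y => ((χ b₀ y : ℝ) : ℂ) • WL2.equiv ℂ _ V u y
    with hgc_def
  have hgc : ∀ b₀ y, WL2.equiv ℂ _ V (gc b₀) y = ((χ b₀ y : ℝ) : ℂ) • WL2.equiv ℂ _ V u y := fun b₀ y => by
    simp only [hgc_def, Equiv.apply_symm_apply]
  -- pure-gauge transporter letters
  have hSR₀ : ∀ b₀ bb w, SP[b₀] bb (RP[b₀] bb w) = w := fun b₀ bb w => adTransportW_inv_adTransportW φ (gaugeU (gf b₀) 1) bb w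
  have hS₀c : ∀ b₀ bb w, ‖SP[b₀] bb w‖ ≤ ‖w‖ := fun b₀ bb w => (norm_adTransportW_pureGauge_inv φ (gf b₀) (hAdf b₀) bb w).le
  -- the currency
  have hBC : ∀ ν, 0 ≤ BC ν := fun ν => hβ.le.trans (hβB ν)
  have hw' : ∀ bb : Bond d N, 0 < BC bb.2 * WT (btgt bb) := fun bb => mul_pos (hβ.trans_le (hβB bb.2)) (weight_site_pos a x₀ (btgt bb))
  have hε₁ : 0 ≤ (c / r + |t| * b) * ((Real.exp a + 1) * ∑ ν, BC ν) := by
    have : 0 ≤ ∑ ν, BC ν := Finset.sum_nonneg fun ν _ => hBC ν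
    positivity
  have hε₂ : 0 ≤ (d : ℝ) * (c / r ^ 2) + |t| * b * (c / r) * ((d : ℝ) * (1 + Real.exp a)) + (d : ℝ) * (t ^ 2 * (b' + b * b)) := by positivity
  refine norm_le_of_gradient_response_bootstrap_pureGauge_family (c₀ := c₁) φ gf hAdf t m a hm x₀ ht ha hlam hn
    (fun bb => WL2.equiv ℂ _ V (covDerivL2K ℂ c₁ (t : ℂ) R u) bb)
    (fun b₀ y => ((χ b₀ y : ℝ) : ℂ) • WL2.equiv ℂ _ V h y)
    (fun b₀ y => -((WL2.equiv ℂ _ V (covLaplaceSiteK (t : ℂ) R S (gc b₀)) y - ((χ b₀ y : ℝ) : ℂ) • WL2.equiv ℂ _ V (covLaplaceSiteK (t : ℂ) R S u) y) +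
        (WL2.equiv ℂ _ V (covLaplaceSiteK (t : ℂ) RP[b₀] SP[b₀] (gc b₀)) y - WL2.equiv ℂ _ V (covLaplaceSiteK (t : ℂ) R S (gc b₀)) y)))
    hε₁ hε₂ hΓ hNu hw' hθ (fun b₀ => ?_) (fun b₀ y => ?_) ?_ bnd
  · -- (REP): (K40) §4 with `k = g_dat − V_dat = T⁰ g` by §1 of (K40), then the conversion slot
    have hk : ∀ y, (((χ b₀ y : ℝ) : ℂ) • WL2.equiv ℂ _ V h y -
        -((WL2.equiv ℂ _ V (covLaplaceSiteK (t : ℂ) R S (gc b₀)) y - ((χ b₀ y : ℝ) : ℂ) • WL2.equiv ℂ _ V (covLaplaceSiteK (t : ℂ) R S u) y) +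
          (WL2.equiv ℂ _ V (covLaplaceSiteK (t : ℂ) RP[b₀] SP[b₀] (gc b₀)) y - WL2.equiv ℂ _ V (covLaplaceSiteK (t : ℂ) R S (gc b₀)) y))) =
        WL2.equiv ℂ _ V (TP[b₀] (gc b₀)) y := fun y => by
      have e := cutoff_comparison_identity (𝕜 := ℂ) t ((m : ℝ) : ℂ) R S RP[b₀] SP[b₀] u h (gc b₀) (χ b₀) hu (hgc b₀) y
      rw [RCLike.ofReal_eq_complex_ofReal] at e
      rw [LinearMap.add_apply, LinearMap.smul_apply, LinearMap.id_apply, e, sub_neg_eq_add, add_assoc]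
    have e := norm_covDeriv_le_response_add (𝕜 := ℂ) t R RP[b₀] TP[b₀] (rePos_covLaplaceSiteK_pureGauge_add φ (gf b₀) (hAdf b₀) t hm) u (gc b₀) (χ b₀)
      (hgc b₀) b₀ (hχp b₀) (hχt b₀) (hδ b₀) _ hk
    exact e.trans (add_le_add le_rfl (conversion_slot_le (WL2.equiv ℂ _ V u) WT hδ0 hβ (hβB b₀.2) hval (btgt b₀)))
  · -- (DATA)
    exact norm_cutoff_data_le (𝕜 := ℂ) (χ b₀) (WL2.equiv ℂ _ V h) WT (hχ1 b₀) hh y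
  · -- (PERT): the natural letter of §2 through (K38)
    refine pert_of_natural_bond ha x₀ BC hBC _ _ (by positivity) fun b₀ y => ?_
    rw [norm_neg]
    exact natural_letter_of_cutoff (𝕜 := ℂ) t R S RP[b₀] SP[b₀] hSR (hSR₀ b₀) hRc hSc (hS₀c b₀) u (gc b₀) (χ b₀) (hgc b₀) (hχ1 b₀) hcr hcr2
      (h1p b₀) (h1m b₀) (h2 b₀) (Ω b₀) (hΩ b₀) hb hb' (hBp b₀) (hBm b₀) (hBt b₀) (hD b₀) ha x₀ hNu hval y

/-! ## §4 The t-free closing: under the mass choice of `B9Eq342GradientRowNaturalPerturbation` §T the contraction binder holds and `1∕(1 − θ) ≤ 2` -/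

/-- arithmetic: `0 ≤ A`, `θ ≤ 1∕2` ⟹ `A∕(1 − θ) ≤ 2A`. [folklore] [cite: Balaban1985BackgroundPropagators, Thm 3.1 (3.42) p.397] -/
theorem div_one_sub_le_two_mul {A θ : ℝ} (hA : 0 ≤ A) (hθ : θ ≤ 1 / 2) : A / (1 - θ) ≤ 2 * A := by
  have h1 : 1 / 2 ≤ 1 - θ := by linarith
  calc A / (1 - θ) ≤ A / (1 / 2) := div_le_div_of_nonneg_left hA (by norm_num) h1
    _ = 2 * A := by ring

include hAdf hm in
/-- **STOREY J ASSEMBLED, t-FREE CLOSING.**  §3 with the contraction binder DISCHARGED: a rate `a ≤ κ`, the per-direction letter `|t|·B_ν ≤ C ≤ K∕√m`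
(`B9Eq342GradientRowComparisonMassUniform` §3∕§4 supply `C = C_W(m,κ,L)`, `K = (1 + 2∕L)√2 + 4 sinh κ` at `a = κ∕t`, `t ≥ 1`, `4d(cosh κ − 1) ≤ m`, `L·t ≤ N_ν`,
`m ≥ 2` — entered here as hypotheses) and ONE mass choice `2·(c∕r + |t|b)·(e^{κ} + 1)·d·K ≤ √m` ⟹ `θ ≤ 1∕2` (`B9Eq342GradientRowNaturalPerturbation.theta_le` ∕
`theta_le_half`) and `‖(∇_U u)(b)‖ ≤ 2·(|t|(Γ + ε₂N_u) + (|t|δ∕β)N_u)·(B_{b.2}·W_{x₀}(b₊))` for EVERY bond `b`. [folklore]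
[cite: Balaban1985BackgroundPropagators, Thm 3.1 (3.42) p.397, (3.35) p.396, (3.43) p.398] -/
theorem norm_covDeriv_le_weighted_of_letters_uniform (ht : 0 < t) (ha : 0 ≤ a) (hlam : 2 * (d : ℝ) * t ^ 2 * (Real.cosh a - 1) < m) (hn : ∀ ν, 2 ≤ N ν)
    (R S : Bond d N → V →ₗ[ℂ] V) (hSR : ∀ b w, S b (R b w) = w) (hRc : ∀ b w, ‖R b w‖ ≤ ‖w‖) (hSc : ∀ b w, ‖S b w‖ ≤ ‖w‖)
    (u h : SiteL2K ℂ d N c₁ V) (hu : covLaplaceSiteK (t : ℂ) R S u + (m : ℂ) • u = h)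
    {Γ Nu : ℝ} (hΓ : 0 ≤ Γ) (hNu : 0 ≤ Nu) (hh : ∀ y, ‖WL2.equiv ℂ _ V h y‖ ≤ Γ * WT y) (hval : ∀ y, ‖WL2.equiv ℂ _ V u y‖ ≤ Nu * WT y)
    (χ : Bond d N → TSite d N → ℝ) (hχ1 : ∀ b₀ y, |χ b₀ y| ≤ 1) (hχp : ∀ b₀, χ b₀ (bpos b₀) = 1) (hχt : ∀ b₀, χ b₀ (btgt b₀) = 1)
    {c r : ℝ} (hcr : 0 ≤ c / r) (hcr2 : 0 ≤ c / r ^ 2) (h1p : ∀ b₀ x μ, |t * (χ b₀ (shift μ x) - χ b₀ x)| ≤ c / r)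
    (h1m : ∀ b₀ x μ, |t * (χ b₀ x - χ b₀ (unshift μ x))| ≤ c / r) (h2 : ∀ b₀ x μ, |t ^ 2 * (2 * χ b₀ x - χ b₀ (shift μ x) - χ b₀ (unshift μ x))| ≤ c / r ^ 2)
    (Ω : Bond d N → Set (TSite d N)) (hΩ : ∀ b₀ x, x ∉ Ω b₀ → χ b₀ x = 0 ∧ (∀ μ, χ b₀ (shift μ x) = 0) ∧ (∀ μ, χ b₀ (unshift μ x) = 0))
    {δ b b' : ℝ} (hδ0 : 0 ≤ δ) (hb : 0 ≤ b) (hb' : 0 ≤ b') (hδ : ∀ b₀ w, ‖R b₀ w - RP[b₀] b₀ w‖ ≤ δ * ‖w‖)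
    (hBp : ∀ b₀, ∀ x ∈ Ω b₀, ∀ μ w, ‖RP[b₀] (x, μ) (S (x, μ) w) - w‖ ≤ b * ‖w‖)
    (hBm : ∀ b₀, ∀ x ∈ Ω b₀, ∀ μ w, ‖RP[b₀] (unshift μ x, μ) (S (unshift μ x, μ) w) - w‖ ≤ b * ‖w‖)
    (hBt : ∀ b₀, ∀ x ∈ Ω b₀, ∀ μ w, ‖SP[b₀] (unshift μ x, μ) w - S (unshift μ x, μ) w‖ ≤ b * ‖w‖)
    (hD : ∀ b₀, ∀ x ∈ Ω b₀, ∀ μ w, ‖(RP[b₀] (x, μ) (S (x, μ) w) - w) -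
      SP[b₀] (unshift μ x, μ) (RP[b₀] (unshift μ x, μ) (S (unshift μ x, μ) (RP[b₀] (unshift μ x, μ) w)) - RP[b₀] (unshift μ x, μ) w)‖ ≤ b' * ‖w‖)
    {β : ℝ} (hβ : 0 < β) (hβB : ∀ ν, β ≤ BC ν)
    {κ C K : ℝ} (haκ : a ≤ κ) (hC : 0 ≤ C) (htB : ∀ ν, ‖(t : ℂ)‖ * BC ν ≤ C) (hCK : C ≤ K / Real.sqrt m)
    (hmK : 2 * ((c / r + |t| * b) * (Real.exp κ + 1) * (d : ℝ) * K) ≤ Real.sqrt m) (bnd : Bond d N) :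
    ‖WL2.equiv ℂ _ V (covDerivL2K ℂ c₁ (t : ℂ) R u) bnd‖ ≤
      2 * (‖(t : ℂ)‖ * (Γ + ((d : ℝ) * (c / r ^ 2) + |t| * b * (c / r) * ((d : ℝ) * (1 + Real.exp a)) + (d : ℝ) * (t ^ 2 * (b' + b * b))) * Nu) +
          |t| * δ / β * Nu) * (BC bnd.2 * WT (btgt bnd)) := by
  have hεn : 0 ≤ c / r + |t| * b := by positivity
  have htB' : ∀ ν, |t| * BC ν ≤ C := fun ν => by have e := htB ν; rwa [Complex.norm_real, Real.norm_eq_abs] at e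
  have hγ : 0 ≤ Real.exp a + 1 := by positivity
  -- θ ≤ 1/2 < 1 by (K38) §T
  have hθle := theta_le BC hεn hγ (Real.exp_le_exp.mpr haκ) hC htB'
  have hpos : 0 ≤ (c / r + |t| * b) * (Real.exp κ + 1) * (d : ℝ) := by positivity
  have hθhalf' := theta_le_half hθle hpos hm hCK hmK
  have hθhalf : ‖(t : ℂ)‖ * ((c / r + |t| * b) * ((Real.exp a + 1) * ∑ ν, BC ν)) ≤ 1 / 2 := by
    rw [Complex.norm_real, Real.norm_eq_abs]; exact hθhalf'
  have hθ : ‖(t : ℂ)‖ * ((c / r + |t| * b) * ((Real.exp a + 1) * ∑ ν, BC ν)) < 1 := hθhalf.trans_lt (by norm_num)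
  have hmain := norm_covDeriv_le_weighted_of_letters φ t m a hm x₀ gf hAdf ht ha hlam hn R S hSR hRc hSc u h hu hΓ hNu hh hval χ hχ1 hχp hχt hcr hcr2
    h1p h1m h2 Ω hΩ hδ0 hb hb' hδ hBp hBm hBt hD hβ hβB hθ bnd
  have hBC : 0 ≤ BC bnd.2 := hβ.le.trans (hβB bnd.2)
  have hw : 0 ≤ BC bnd.2 * WT (btgt bnd) := mul_nonneg hBC (weight_site_pos a x₀ (btgt bnd)).le
  have hA : 0 ≤ ‖(t : ℂ)‖ * (Γ + ((d : ℝ) * (c / r ^ 2) + |t| * b * (c / r) * ((d : ℝ) * (1 + Real.exp a)) + (d : ℝ) * (t ^ 2 * (b' + b * b))) * Nu) +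
      |t| * δ / β * Nu := by positivity
  exact hmain.trans (mul_le_mul_of_nonneg_right (div_one_sub_le_two_mul hA hθhalf) hw)

/-! ## §5 An order-zero term of the operator (print's averaging penalty `Q′*a′Q′` of (3.24)) is DATA: no smallness needed -/

include hAdf hm in
/-- **THE PENALTY IS A DATA TERM.**  If `(Δ_U + m)u + p = h` with a weighted value bound `‖p(y)‖ ≤ N_p·W_{x₀}(y)` on the extra term (e.g. `p = a′Q′*Q′u`,
block-local and bounded: `N_p = ‖a′Q′*Q′‖_{∞→∞}·e^{a·range}·N_u`), then §3 applies with the data `h − p` and `Γ + N_p` in place of `Γ` — the contraction letter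
`ε₁` is unchanged, so an order-zero bounded term in the resolvent costs NOTHING in smallness. [folklore]
[cite: Balaban1985BackgroundPropagators, (3.24) p.394, Thm 3.1 (3.42) p.397] -/
theorem norm_covDeriv_le_weighted_of_letters_penalty (ht : 0 < t) (ha : 0 ≤ a) (hlam : 2 * (d : ℝ) * t ^ 2 * (Real.cosh a - 1) < m)
    (hn : ∀ ν, 2 ≤ N ν) (R S : Bond d N → V →ₗ[ℂ] V) (hSR : ∀ b w, S b (R b w) = w) (hRc : ∀ b w, ‖R b w‖ ≤ ‖w‖) (hSc : ∀ b w, ‖S b w‖ ≤ ‖w‖)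
    (u h p : SiteL2K ℂ d N c₁ V) (hu : covLaplaceSiteK (t : ℂ) R S u + (m : ℂ) • u + p = h)
    {Γ Np Nu : ℝ} (hΓ : 0 ≤ Γ) (hNp : 0 ≤ Np) (hNu : 0 ≤ Nu) (hh : ∀ y, ‖WL2.equiv ℂ _ V h y‖ ≤ Γ * WT y)
    (hp : ∀ y, ‖WL2.equiv ℂ _ V p y‖ ≤ Np * WT y) (hval : ∀ y, ‖WL2.equiv ℂ _ V u y‖ ≤ Nu * WT y)
    (χ : Bond d N → TSite d N → ℝ) (hχ1 : ∀ b₀ y, |χ b₀ y| ≤ 1) (hχp : ∀ b₀, χ b₀ (bpos b₀) = 1) (hχt : ∀ b₀, χ b₀ (btgt b₀) = 1)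
    {c r : ℝ} (hcr : 0 ≤ c / r) (hcr2 : 0 ≤ c / r ^ 2) (h1p : ∀ b₀ x μ, |t * (χ b₀ (shift μ x) - χ b₀ x)| ≤ c / r)
    (h1m : ∀ b₀ x μ, |t * (χ b₀ x - χ b₀ (unshift μ x))| ≤ c / r) (h2 : ∀ b₀ x μ, |t ^ 2 * (2 * χ b₀ x - χ b₀ (shift μ x) - χ b₀ (unshift μ x))| ≤ c / r ^ 2)
    (Ω : Bond d N → Set (TSite d N)) (hΩ : ∀ b₀ x, x ∉ Ω b₀ → χ b₀ x = 0 ∧ (∀ μ, χ b₀ (shift μ x) = 0) ∧ (∀ μ, χ b₀ (unshift μ x) = 0))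
    {δ b b' : ℝ} (hδ0 : 0 ≤ δ) (hb : 0 ≤ b) (hb' : 0 ≤ b') (hδ : ∀ b₀ w, ‖R b₀ w - RP[b₀] b₀ w‖ ≤ δ * ‖w‖)
    (hBp : ∀ b₀, ∀ x ∈ Ω b₀, ∀ μ w, ‖RP[b₀] (x, μ) (S (x, μ) w) - w‖ ≤ b * ‖w‖)
    (hBm : ∀ b₀, ∀ x ∈ Ω b₀, ∀ μ w, ‖RP[b₀] (unshift μ x, μ) (S (unshift μ x, μ) w) - w‖ ≤ b * ‖w‖)
    (hBt : ∀ b₀, ∀ x ∈ Ω b₀, ∀ μ w, ‖SP[b₀] (unshift μ x, μ) w - S (unshift μ x, μ) w‖ ≤ b * ‖w‖)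
    (hD : ∀ b₀, ∀ x ∈ Ω b₀, ∀ μ w, ‖(RP[b₀] (x, μ) (S (x, μ) w) - w) -
      SP[b₀] (unshift μ x, μ) (RP[b₀] (unshift μ x, μ) (S (unshift μ x, μ) (RP[b₀] (unshift μ x, μ) w)) - RP[b₀] (unshift μ x, μ) w)‖ ≤ b' * ‖w‖)
    {β : ℝ} (hβ : 0 < β) (hβB : ∀ ν, β ≤ BC ν)
    (hθ : ‖(t : ℂ)‖ * ((c / r + |t| * b) * ((Real.exp a + 1) * ∑ ν, BC ν)) < 1) (bnd : Bond d N) :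
    ‖WL2.equiv ℂ _ V (covDerivL2K ℂ c₁ (t : ℂ) R u) bnd‖ ≤
      (‖(t : ℂ)‖ * ((Γ + Np) + ((d : ℝ) * (c / r ^ 2) + |t| * b * (c / r) * ((d : ℝ) * (1 + Real.exp a)) + (d : ℝ) * (t ^ 2 * (b' + b * b))) * Nu) +
          |t| * δ / β * Nu) / (1 - ‖(t : ℂ)‖ * ((c / r + |t| * b) * ((Real.exp a + 1) * ∑ ν, BC ν))) * (BC bnd.2 * WT (btgt bnd)) := by
  have hu' : covLaplaceSiteK (t : ℂ) R S u + (m : ℂ) • u = h - p := by rw [← hu]; abel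
  have hh' : ∀ y, ‖WL2.equiv ℂ _ V (h - p) y‖ ≤ (Γ + Np) * WT y := fun y => by
    rw [WL2.equiv_sub, Pi.sub_apply]
    calc ‖WL2.equiv ℂ _ V h y - WL2.equiv ℂ _ V p y‖ ≤ ‖WL2.equiv ℂ _ V h y‖ + ‖WL2.equiv ℂ _ V p y‖ := norm_sub_le _ _
      _ ≤ Γ * WT y + Np * WT y := add_le_add (hh y) (hp y)
      _ = (Γ + Np) * WT y := by ring
  exact norm_covDeriv_le_weighted_of_letters φ t m a hm x₀ gf hAdf ht ha hlam hn R S hSR hRc hSc u (h - p) hu' (add_nonneg hΓ hNp) hNu hh' hval χ hχ1 hχp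
    hχt hcr hcr2 h1p h1m h2 Ω hΩ hδ0 hb hb' hδ hBp hBm hBt hD hβ hβB hθ bnd

end Assembly

end Literature.MathematicalPhysics.QuantumFieldTheory.Balaban1983to89.B9Eq342GradientRowAssembly

end
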